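import Summits.QuantumFields.BalabanUV.Beta.GAN24.CurrentSymTowerOfTables
import Summits.QuantumFields.BalabanUV.Beta.GAN24.SymVHClassCurrentSym
import Summits.QuantumFields.BalabanUV.Beta.GAN24.CombForcingPairForm

/-!
# `BalabanUV.Beta.GAN24.CurrentSymTowerComb` — binder row G-an2-4 ∕ (CONV-C), TRANSFER-III, **THE (III′) CURRENT-SYMMETRY TOWER AT ROW D1's LITERAL OF RECORD: EVERY SLOT↔LEG-SYMMETRISED
# CLASS-WEIGHTED TWO-LEG CURRENT OF an2's COMB-CHART SLOT FAMILIES `ScombOf (symTablesAn1S2 d Lc cΛt)` ∕ `SpureCombOf (symTablesAn1S2 d Lc cΛt)` VANISHES AT EVERY LEVEL AND EVERY FREE LEG** —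
# the (III′) twin of this lineage's F5 `CurrentSymTower.sym_SpureRecAt`; at `d = 3` it IS the ONE displayed letter `hCS` of leaf-02 g78's (G) `CombForcingPairForm` §5, so road-P2's `hBF m i` SHAPE
# for the comb-chart forcing at an1's record holds with NO displayed hypothesis (`forcingFacePairForms_comb_an1_holds`).

NOT IN PRINT; OUR BOOKKEEPING ([folklore] instantiation BY NAME of this gen's (M4a) `CurrentSymTowerOfTables.sym_SrecOf_all ∕ sym_SpureRecOf` at: (LV)(LH) an1's `symVhSAt_hV_ctr ∕ symHessFFAt_hH_ctr`,
the V-letter = this gen's (M2) `SymVHClassCurrentSym.symVhSAt_classCurrent_add_swap_eq_zero` at the centred root `ctrOff (d+1) Lc`, (DG)(SG) an2's `CombChartStepJets.decays_GcombSh` ∕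
`CombChartWardSockets.trK_GcombSh`, (R-H) leaf-02 g78's (A) `ColumnResponseOfWardLetters.tsum_coord_colH_GcombSh`, (R-M) this gen's (M1b) `CubicSectorCurrentSymOfWardLetters.tsum_coord_mm_GcombSh`;
the bridges `CombChartStepJets.ScombOf_eq ∕ SpureCombOf_eq`, `SymSecondOrderTablesAn1.symTablesAn1S2_V ∕ _H`; the discharge into leaf-02 g78's (G) `CombForcingPairForm.forcingFacePairForms_comb_an1_of_currentSym`;
G-an2-4 CRUX TEAM (2), leaf prover `b2b-balaban-gan24-formalise-leaf-04`, gen 77).  HONEST FRAMING (cell contract, verbatim): «discharging `BetaPertH` makes Bałaban's UV stability UNCONDITIONAL — a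
real constructive-QFT result; it is NOT the continuum limit and NOT the Clay problem.»  HONEST DEPENDENCY (verbatim): «continuum YM on T⁴ ⇐ BetaPertH ∧ nine spine estimates (0/9 proved); BetaPertH ⇐
(D1) ∧ (D4) ∧ CAP+tail; G-an2-4 gates asym, D1 and NE2/3/4.»

WHAT ([folklore]; `[NeZero Lc]`, generic `d` in §1–§2, `d = 3` in §3; all `cΛt cE cVH cΛ`; 0 `def`, 0 cited facts, 0 `def … : Prop`, 0 sorry): §1 `exists_colH_response_GcombSh` ((R-H) for
`G′_j` with `∃ cH`); **`sym_ScombOf_an1S2`** (every `j ν β`, all face-supported class data, every free leg); §2 **`sym_SpureCombOf_an1S2`** (the pure tables); §3 **`hCS_holds`** = (G) §5's binder `hCS`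
VERBATIM (`d = 3`) and **`forcingFacePairForms_comb_an1_holds`** = (G) §5's conclusion with `hCS` DISCHARGED: for `1 ≤ Lc`, all colour constants, any period tower `P 0 = Lc`, `P (m+1) = Lc·P m`:
«∀ m i, road-P2's `hBF m i` SHAPE (an antisymmetric-pair form `T`) for the comb-chart forcing at `symTablesAn1S2 3 Lc cΛt`».  WHAT IT IS NOT: road-P2's comb-chart charge TOWER at (III′) (`hstep`
displays, closure, crossed VALUE ledger) is NOT typed here; the cell supplier `hB0`'s (III′) twin is NOT here; asserts NO value of Bałaban's tables; discharges NOTHING of (C)sym ∕ (hW, hWall) ∕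
(hS, hSall) as wall rows; NEVER «G-an2-4 closed» as (CONV-C); NOT D1, NOT `BetaPertH`, NOT continuum, NOT Clay.  2026-08-25; no existing file touched.
-/

noncomputable section

open Finset
open scoped BigOperators
open Literature.MathematicalPhysics.QuantumFieldTheory
open Literature.MathematicalPhysics.QuantumFieldTheory.Balaban1983to89
open Literature.MathematicalPhysics.QuantumFieldTheory.Balaban1983to89.Beta
open ExpKernelCalculus (Site MKer)
open AffineAveraging (box toSite)
open AveragingContours (blk)
open AveragingContoursRooted (ctr ctrOff ctrOff_mem_box)
open OneStepResolventKernel (Fib)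
open OneStepKernelFamily (colH)
open SecondOrderResponse (W2SymOfK)
open BalabanStepJetsSucc (mmRead)
open BalabanStepW2 (K3OfK M2Of)
open Summit.QuantumFields.BalabanUV.Beta.BorderedHessian (stepScale)
open Summit.QuantumFields.BalabanUV.Beta.HessKerDressedUnits (unitK unitS)
open Summit.QuantumFields.BalabanUV.Beta.SecondOrderUnits (unitM unitM₂)
open Summit.QuantumFields.BalabanUV.Beta.SymAveragingHessianCounts (symVhSAt_hV_ctr symHessFFAt_hH_ctr)
open Summit.QuantumFields.BalabanUV.Beta.SymSecondOrderTablesAn1 (symTablesAn1S2 symTablesAn1S2_V symTablesAn1S2_H)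
open Summit.QuantumFields.BalabanUV.Beta.CombChartStepJets (GcombSh ScombOf SpureCombOf ScombOf_eq SpureCombOf_eq decays_GcombSh)
open Summit.QuantumFields.BalabanUV.Beta.CombChartWardSockets (trK_GcombSh)
open Summit.QuantumFields.BalabanUV.Beta.GAN24.CombesThomas (sfStep smStep)
open Summit.QuantumFields.BalabanUV.Beta.GAN24.ColumnResponseOfWardLetters (tsum_coord_colH_GcombSh)
open Summit.QuantumFields.BalabanUV.Beta.GAN24.CubicSectorCurrentSymOfWardLetters (tsum_coord_mm_GcombSh)
open Summit.QuantumFields.BalabanUV.Beta.GAN24.SymVHClassCurrentSym (symVhSAt_classCurrent_add_swap_eq_zero)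
open Summit.QuantumFields.BalabanUV.Beta.GAN24.CurrentSymTowerOfTables (sym_SrecOf_all sym_SpureRecOf)
open Summit.QuantumFields.BalabanUV.Beta.GAN24.CombForcingPairForm (forcingFacePairForms_comb_an1_of_currentSym)

namespace Summit.QuantumFields.BalabanUV.Beta.GAN24.CurrentSymTowerComb

variable {d : ℕ} {Lc : ℕ} [NeZero Lc]

/-! ## §1 The slotted tower at an1's record with an2's comb-chart resolvents -/

/-- [folklore] **(R-H) FOR `G′_j`, PACKAGED WITH ITS CONSTANT**: `∃ cH, ∀ a f (bdd) κ u, Σ'_y f(y_a)·colH G′_j Lc a y κ u = cH·𝟙[κ = a ∧ u_a ≡ −1]·f((blk u)_a)` (`cH = cH_j` of leaf-02's (A)). -/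
theorem exists_colH_response_GcombSh (j : ℕ) :
    ∃ cH : ℝ, ∀ (a : Fin (d + 1)) (f : ℤ → ℝ) (B : ℝ), (∀ s, |f s| ≤ B) → ∀ (κ : Fin (d + 1)) (u : Site (d + 1)),
      ∑' y : Site (d + 1), f (y a) * colH (GcombSh (d := d) Lc j) Lc a y κ u = cH * (if κ = a ∧ u a % (Lc : ℤ) = (Lc : ℤ) - 1 then f (blk Lc u a) else 0) :=
  ⟨(stepScale d Lc j * (Lc : ℝ) ^ (d + 1))⁻¹, fun a f _ hf κ u => tsum_coord_colH_GcombSh Lc j a f hf κ u⟩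

/-- NOT IN PRINT; OUR BOOKKEEPING.  **THE (III′) (A)-TOWER FOR THE FULL TABLES**: for every `j`, all `ν β`, all face-supported class data and every free leg `(p, a)`,
`P_{ScombOf (symTablesAn1S2 d Lc cΛt) cE cVH cΛ j}[c₂+dΨ₂, c₁+dΨ₁](p,a) = 0` — (M4a) `sym_SrecOf_all` at `V := symVhSAt ρ_c d Lc` ((LV) `symVhSAt_hV_ctr`, V-letter = (M2) at the centred root),
`H := symHessFFAt ρ_c Lc` ((LH) `symHessFFAt_hH_ctr`), `G := GcombSh Lc` ((DG)(SG)(R-H)(R-M) by an2 ∕ leaf-02 (A) ∕ (M1b)). -/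
theorem sym_ScombOf_an1S2 (cΛt cE cVH cΛ : ℝ) :
    ∀ (j : ℕ) (ν β : Fin (d + 1)) (c₁ : ℝ) (Ψ₁ : ℤ → ℝ) (B₁ : ℝ), (∀ s, |Ψ₁ s| ≤ B₁) → (∀ n : ℤ, n % (Lc : ℤ) ≠ (Lc : ℤ) - 1 → c₁ + (Ψ₁ (n + 1) - Ψ₁ n) = 0) →
      ∀ (c₂ : ℝ) (Ψ₂ : ℤ → ℝ) (B₂ : ℝ), (∀ s, |Ψ₂ s| ≤ B₂) → (∀ n : ℤ, n % (Lc : ℤ) ≠ (Lc : ℤ) - 1 → c₂ + (Ψ₂ (n + 1) - Ψ₂ n) = 0) →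
      ∀ (p : Site (d + 1)) (a : Fib d),
        (∑' q : Site (d + 1), (c₁ + (Ψ₁ (q β + 1) - Ψ₁ (q β))) * ∑' u : Site (d + 1), (c₂ + (Ψ₂ (u ν + 1) - Ψ₂ (u ν))) *
            ScombOf (symTablesAn1S2 d Lc cΛt) cE cVH cΛ j ν u q p (Sum.inl β) a) +
          ∑' q : Site (d + 1), (c₂ + (Ψ₂ (q ν + 1) - Ψ₂ (q ν))) * ∑' u : Site (d + 1), (c₁ + (Ψ₁ (u β + 1) - Ψ₁ (u β))) *
            ScombOf (symTablesAn1S2 d Lc cΛt) cE cVH cΛ j β u q p (Sum.inl ν) a = 0 := by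
  have hLc : 1 ≤ Lc := Nat.one_le_iff_ne_zero.mpr (NeZero.ne Lc)
  intro j ν β c₁ Ψ₁ B₁ hΨ₁ hf₁ c₂ Ψ₂ B₂ hΨ₂ hf₂ p a
  rw [ScombOf_eq, symTablesAn1S2_V, symTablesAn1S2_H]
  exact sym_SrecOf_all (symVhSAt_hV_ctr hLc) (symHessFFAt_hH_ctr hLc) (decays_GcombSh (d := d) Lc) (fun j => trK_GcombSh (d := d) (Lc := Lc) j)
    (fun j => exists_colH_response_GcombSh (d := d) (Lc := Lc) j) (fun j a f B hf m q => tsum_coord_mm_GcombSh Lc j a f hf m q)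
    (fun ν β h s hh hs p a => symVhSAt_classCurrent_add_swap_eq_zero hLc (ctrOff_mem_box hLc) ν β hh hs p a)
    cE cVH cΛ j ν β c₁ Ψ₁ B₁ hΨ₁ hf₁ c₂ Ψ₂ B₂ hΨ₂ hf₂ p a

/-! ## §2 The pure tables -/

/-- NOT IN PRINT; OUR BOOKKEEPING.  **THE (III′) (A)-TOWER FOR THE PURE TABLES `SpureCombOf (symTablesAn1S2 d Lc cΛt) cE cVH cΛ j`** (every `j`; the (III′) twin of F5's `sym_SpureRecAt`):
for all face-supported class data `c₁ + dΨ₁` (leg), `c₂ + dΨ₂` (slot) and every free leg `(p, a)`, `P_{SpureCombOf …j}[c₂+dΨ₂, c₁+dΨ₁](p,a) = 0`. -/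
theorem sym_SpureCombOf_an1S2 (cΛt cE cVH cΛ : ℝ) :
    ∀ (j : ℕ) (ν β : Fin (d + 1)) (c₁ : ℝ) (Ψ₁ : ℤ → ℝ) (B₁ : ℝ), (∀ s, |Ψ₁ s| ≤ B₁) → (∀ n : ℤ, n % (Lc : ℤ) ≠ (Lc : ℤ) - 1 → c₁ + (Ψ₁ (n + 1) - Ψ₁ n) = 0) →
      ∀ (c₂ : ℝ) (Ψ₂ : ℤ → ℝ) (B₂ : ℝ), (∀ s, |Ψ₂ s| ≤ B₂) → (∀ n : ℤ, n % (Lc : ℤ) ≠ (Lc : ℤ) - 1 → c₂ + (Ψ₂ (n + 1) - Ψ₂ n) = 0) →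
      ∀ (p : Site (d + 1)) (a : Fib d),
        (∑' q : Site (d + 1), (c₁ + (Ψ₁ (q β + 1) - Ψ₁ (q β))) * ∑' u : Site (d + 1), (c₂ + (Ψ₂ (u ν + 1) - Ψ₂ (u ν))) *
            SpureCombOf (symTablesAn1S2 d Lc cΛt) cE cVH cΛ j ν u q p (Sum.inl β) a) +
          ∑' q : Site (d + 1), (c₂ + (Ψ₂ (q ν + 1) - Ψ₂ (q ν))) * ∑' u : Site (d + 1), (c₁ + (Ψ₁ (u β + 1) - Ψ₁ (u β))) *
            SpureCombOf (symTablesAn1S2 d Lc cΛt) cE cVH cΛ j β u q p (Sum.inl ν) a = 0 := by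
  have hLc : 1 ≤ Lc := Nat.one_le_iff_ne_zero.mpr (NeZero.ne Lc)
  intro j ν β c₁ Ψ₁ B₁ hΨ₁ hf₁ c₂ Ψ₂ B₂ hΨ₂ hf₂ p a
  rw [SpureCombOf_eq, symTablesAn1S2_V, symTablesAn1S2_H]
  exact sym_SpureRecOf (symVhSAt_hV_ctr hLc) (symHessFFAt_hH_ctr hLc) (decays_GcombSh (d := d) Lc) (fun j => trK_GcombSh (d := d) (Lc := Lc) j)
    (fun j => exists_colH_response_GcombSh (d := d) (Lc := Lc) j) (fun j a f B hf m q => tsum_coord_mm_GcombSh Lc j a f hf m q)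
    (fun ν β h s hh hs p a => symVhSAt_classCurrent_add_swap_eq_zero hLc (ctrOff_mem_box hLc) ν β hh hs p a)
    cE cVH cΛ j ν β c₁ Ψ₁ hΨ₁ hf₁ c₂ Ψ₂ hΨ₂ hf₂ p a

end Summit.QuantumFields.BalabanUV.Beta.GAN24.CurrentSymTowerComb

/-! ## §3 `d = 3`: the letter `hCS` of (G) `CombForcingPairForm` §5 and road-P2's `hBF` shape with it discharged -/

namespace Summit.QuantumFields.BalabanUV.Beta.GAN24.CurrentSymTowerComb

variable {Lc : ℕ} [NeZero Lc]

/-- NOT IN PRINT; OUR BOOKKEEPING.  **`hCS` HOLDS** — the ONE displayed letter of leaf-02 g78's (G) `CombForcingPairForm.forcingFacePairForms_comb_an1_of_currentSym`, VERBATIM (`d = 3`): the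
class-current symmetry of `SpureCombOf (symTablesAn1S2 3 Lc cΛt) cE cVH cΛ i` at every level `i`. -/
theorem hCS_holds (cΛt cE cVH cΛ : ℝ) :
    ∀ (i : ℕ) (ν β : Fin (3 + 1)) (c₁ : ℝ) (Ψ₁ : ℤ → ℝ) (B₁ : ℝ), (∀ s, |Ψ₁ s| ≤ B₁) → (∀ n : ℤ, n % (Lc : ℤ) ≠ (Lc : ℤ) - 1 → c₁ + (Ψ₁ (n + 1) - Ψ₁ n) = 0) →
      ∀ (c₂ : ℝ) (Ψ₂ : ℤ → ℝ) (B₂ : ℝ), (∀ s, |Ψ₂ s| ≤ B₂) → (∀ n : ℤ, n % (Lc : ℤ) ≠ (Lc : ℤ) - 1 → c₂ + (Ψ₂ (n + 1) - Ψ₂ n) = 0) →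
      ∀ (p : Site (3 + 1)) (a : Fib 3),
        (∑' q : Site (3 + 1), (c₁ + (Ψ₁ (q β + 1) - Ψ₁ (q β))) * ∑' u : Site (3 + 1), (c₂ + (Ψ₂ (u ν + 1) - Ψ₂ (u ν))) *
            SpureCombOf (symTablesAn1S2 3 Lc cΛt) cE cVH cΛ i ν u q p (Sum.inl β) a) +
          ∑' q : Site (3 + 1), (c₂ + (Ψ₂ (q ν + 1) - Ψ₂ (q ν))) * ∑' u : Site (3 + 1), (c₁ + (Ψ₁ (u β + 1) - Ψ₁ (u β))) *
            SpureCombOf (symTablesAn1S2 3 Lc cΛt) cE cVH cΛ i β u q p (Sum.inl ν) a = 0 :=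
  sym_SpureCombOf_an1S2 (d := 3) cΛt cE cVH cΛ

set_option maxHeartbeats 400000 in
/-- NOT IN PRINT; OUR BOOKKEEPING.  **road-P2's `hBF m i` SHAPE FOR THE COMB-CHART FORCING AT an1's RECORD — NO DISPLAYED HYPOTHESIS LEFT** (`1 ≤ Lc`, all `cΛt cE cVH cΛ cE₂ cB`, any period tower
`P 0 = Lc`, `P (m+1) = Lc·P m`): leaf-02 g78's (G) §5 `forcingFacePairForms_comb_an1_of_currentSym` with its letter `hCS := hCS_holds`.  (The heartbeat ceiling is (G)'s own, for the
statement's elaboration.)  WHAT IT IS NOT: road-P2's comb-chart charge tower ∕ closure ∕ crossed ledger at (III′); NOT (C)sym as a wall row; NEVER «G-an2-4 closed» as (CONV-C). -/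
theorem forcingFacePairForms_comb_an1_holds (hLc : 1 ≤ Lc) (cΛt cE cVH cΛ cE₂ cB : ℝ) (P : ℕ → ℕ) (hP0 : P 0 = Lc) (hPs : ∀ m, P (m + 1) = Lc * P m) :
    ∀ (m i : ℕ), ∃ T : Fin (3 + 1) → Fin (3 + 1) → Fin (3 + 1) → Fin (3 + 1) → ℝ,
      (∀ a b c e : Fin (3 + 1), T b a c e = -T a b c e) ∧ (∀ a b c e : Fin (3 + 1), T a b e c = -T a b c e) ∧
      ∀ κ κ' κ₁ κ₂ : Fin (3 + 1),
        (((∑ bb ∈ box (3 + 1) (P m), ∑' u' : Site (3 + 1), ∑' x : Site (3 + 1), ∑' z : Site (3 + 1),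
          (if toSite bb κ % ((P m : ℕ) : ℤ) = ((P m : ℕ) : ℤ) - 1 ∧ u' κ' % ((P m : ℕ) : ℤ) = ((P m : ℕ) : ℤ) - 1 ∧ x κ₁ % ((P m : ℕ) : ℤ) = ((P m : ℕ) : ℤ) - 1 ∧ z κ₂ % ((P m : ℕ) : ℤ) = ((P m : ℕ) : ℤ) - 1 then
            ((fun κ u κ' u' => (cE₂ * (Lc : ℝ) ^ (2 * (3 + 1))) • mmRead Lc (K3OfK (unitK (sfStep Lc i) (smStep 3 Lc i) (GcombSh (d := 3) Lc i)) Lc (unitS (sfStep Lc i) (smStep 3 Lc i) (SpureCombOf (symTablesAn1S2 3 Lc cΛt) cE cVH cΛ i)) (unitM (sfStep Lc i) (smStep 3 Lc i) ((symTablesAn1S2 3 Lc cΛt).M i)) (W2SymOfK (unitK (sfStep Lc i) (smStep 3 Lc i) (GcombSh (d := 3) Lc i)) Lc (unitS (sfStep Lc i) (smStep 3 Lc i) (SpureCombOf (symTablesAn1S2 3 Lc cΛt) cE cVH cΛ i)) (unitM (sfStep Lc i) (smStep 3 Lc i) ((symTablesAn1S2 3 Lc cΛt).M i)) 0 (unitM₂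 (sfStep Lc i) (smStep 3 Lc i) (M2Of 3 Lc ((symTablesAn1S2 3 Lc cΛt).mixFF) i))) κ u κ' u') + cB • (symTablesAn1S2 3 Lc cΛt).vh₂S κ u κ' u')) κ (toSite bb) κ' u' x z (Sum.inl κ₁) (Sum.inl κ₂) else 0))
        + (∑ bb ∈ box (3 + 1) (P m), ∑' u' : Site (3 + 1), ∑' x : Site (3 + 1), ∑' z : Site (3 + 1),
          (if toSite bb κ' % ((P m : ℕ) : ℤ) = ((P m : ℕ) : ℤ) - 1 ∧ u' κ % ((P m : ℕ) : ℤ) = ((P m : ℕ) : ℤ) - 1 ∧ x κ₁ % ((P m : ℕ) : ℤ) = ((P m : ℕ) : ℤ) - 1 ∧ z κ₂ % ((P m : ℕ) : ℤ) = ((P m : ℕ) : ℤ) - 1 then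
            ((fun κ u κ' u' => (cE₂ * (Lc : ℝ) ^ (2 * (3 + 1))) • mmRead Lc (K3OfK (unitK (sfStep Lc i) (smStep 3 Lc i) (GcombSh (d := 3) Lc i)) Lc (unitS (sfStep Lc i) (smStep 3 Lc i) (SpureCombOf (symTablesAn1S2 3 Lc cΛt) cE cVH cΛ i)) (unitM (sfStep Lc i) (smStep 3 Lc i) ((symTablesAn1S2 3 Lc cΛt).M i)) (W2SymOfK (unitK (sfStep Lc i) (smStep 3 Lc i) (GcombSh (d := 3) Lc i)) Lc (unitS (sfStep Lc i) (smStep 3 Lc i) (SpureCombOf (symTablesAn1S2 3 Lc cΛt) cE cVH cΛ i)) (unitM (sfStep Lc i) (smStep 3 Lc i) ((symTablesAn1S2 3 Lc cΛt).M i)) 0 (unitM₂ (sfStep Lc i) (smStep 3 Lc i) (M2Of 3 Lc ((symTablesAn1S2 3 Lc cΛt).mixFF) i))) κ u κ' u') + cB • (symTablesAn1S2 3 Lc cΛt).vh₂S κ u κ' u')) κ' (toSite bb) κ u' x z (Sum.inl κ₁) (Sum.inl κ₂) else 0)))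
      + ((∑ bb ∈ box (3 + 1) (P m), ∑' u' : Site (3 + 1), ∑' x : Site (3 + 1), ∑' z : Site (3 + 1),
          (if toSite bb κ' % ((P m : ℕ) : ℤ) = ((P m : ℕ) : ℤ) - 1 ∧ u' κ % ((P m : ℕ) : ℤ) = ((P m : ℕ) : ℤ) - 1 ∧ x κ₁ % ((P m : ℕ) : ℤ) = ((P m : ℕ) : ℤ) - 1 ∧ z κ₂ % ((P m : ℕ) : ℤ) = ((P m : ℕ) : ℤ) - 1 then
            ((fun κ u κ' u' => (cE₂ * (Lc : ℝ) ^ (2 * (3 + 1))) • mmRead Lc (K3OfK (unitK (sfStep Lc i) (smStep 3 Lc i) (GcombSh (d := 3) Lc i)) Lc (unitS (sfStep Lc i) (smStep 3 Lc i) (SpureCombOf (symTablesAn1S2 3 Lc cΛt) cE cVH cΛ i)) (unitM (sfStep Lc i) (smStep 3 Lc i) ((symTablesAn1S2 3 Lc cΛt).M i)) (W2SymOfK (unitK (sfStep Lc i) (smStep 3 Lc i) (GcombSh (d := 3) Lc i)) Lc (unitS (sfStep Lc i) (smStep 3 Lc i) (SpureCombOf (symTablesAn1S2 3 Lc cΛt)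 cE cVH cΛ i)) (unitM (sfStep Lc i) (smStep 3 Lc i) ((symTablesAn1S2 3 Lc cΛt).M i)) 0 (unitM₂ (sfStep Lc i) (smStep 3 Lc i) (M2Of 3 Lc ((symTablesAn1S2 3 Lc cΛt).mixFF) i))) κ u κ' u') + cB • (symTablesAn1S2 3 Lc cΛt).vh₂S κ u κ' u')) κ' (toSite bb) κ u' x z (Sum.inl κ₁) (Sum.inl κ₂) else 0))
        + (∑ bb ∈ box (3 + 1) (P m), ∑' u' : Site (3 + 1), ∑' x : Site (3 + 1), ∑' z : Site (3 + 1),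
          (if toSite bb κ % ((P m : ℕ) : ℤ) = ((P m : ℕ) : ℤ) - 1 ∧ u' κ' % ((P m : ℕ) : ℤ) = ((P m : ℕ) : ℤ) - 1 ∧ x κ₁ % ((P m : ℕ) : ℤ) = ((P m : ℕ) : ℤ) - 1 ∧ z κ₂ % ((P m : ℕ) : ℤ) = ((P m : ℕ) : ℤ) - 1 then
            ((fun κ u κ' u' => (cE₂ * (Lc : ℝ) ^ (2 * (3 + 1))) • mmRead Lc (K3OfK (unitK (sfStep Lc i) (smStep 3 Lc i) (GcombSh (d := 3) Lc i)) Lc (unitS (sfStep Lc i) (smStep 3 Lc i) (SpureCombOf (symTablesAn1S2 3 Lc cΛt) cE cVH cΛ i)) (unitM (sfStep Lc i) (smStep 3 Lc i) ((symTablesAn1S2 3 Lc cΛt).M i)) (W2SymOfK (unitK (sfStep Lc i) (smStep 3 Lc i) (GcombSh (d := 3) Lc i)) Lc (unitS (sfStep Lc i) (smStep 3 Lc i) (SpureCombOf (symTablesAn1S2 3 Lc cΛt) cE cVH cΛ i)) (unitM (sfStep Lc i) (smStep 3 Lc i) ((symTablesAn1S2 3 Lc cΛt).M i)) 0 (unitM₂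 (sfStep Lc i) (smStep 3 Lc i) (M2Of 3 Lc ((symTablesAn1S2 3 Lc cΛt).mixFF) i))) κ u κ' u') + cB • (symTablesAn1S2 3 Lc cΛt).vh₂S κ u κ' u')) κ (toSite bb) κ' u' x z (Sum.inl κ₁) (Sum.inl κ₂) else 0)))
      + (((∑ bb ∈ box (3 + 1) (P m), ∑' u' : Site (3 + 1), ∑' x : Site (3 + 1), ∑' z : Site (3 + 1),
          (if toSite bb κ % ((P m : ℕ) : ℤ) = ((P m : ℕ) : ℤ) - 1 ∧ u' κ' % ((P m : ℕ) : ℤ) = ((P m : ℕ) : ℤ) - 1 ∧ x κ₂ % ((P m : ℕ) : ℤ) = ((P m : ℕ) : ℤ) - 1 ∧ z κ₁ % ((P m : ℕ) : ℤ) = ((P m : ℕ) : ℤ) - 1 then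
            ((fun κ u κ' u' => (cE₂ * (Lc : ℝ) ^ (2 * (3 + 1))) • mmRead Lc (K3OfK (unitK (sfStep Lc i) (smStep 3 Lc i) (GcombSh (d := 3) Lc i)) Lc (unitS (sfStep Lc i) (smStep 3 Lc i) (SpureCombOf (symTablesAn1S2 3 Lc cΛt) cE cVH cΛ i)) (unitM (sfStep Lc i) (smStep 3 Lc i) ((symTablesAn1S2 3 Lc cΛt).M i)) (W2SymOfK (unitK (sfStep Lc i) (smStep 3 Lc i) (GcombSh (d := 3) Lc i)) Lc (unitS (sfStep Lc i) (smStep 3 Lc i) (SpureCombOf (symTablesAn1S2 3 Lc cΛt) cE cVH cΛ i)) (unitM (sfStep Lc i) (smStep 3 Lc i) ((symTablesAn1S2 3 Lc cΛt).M i)) 0 (unitM₂ (sfStep Lc i) (smStep 3 Lc i) (M2Of 3 Lc ((symTablesAn1S2 3 Lc cΛt).mixFF) i))) κ u κ' u') + cB • (symTablesAn1S2 3 Lc cΛt).vh₂S κ u κ' u')) κ (toSite bb) κ' u' x z (Sum.inl κ₂) (Sum.inl κ₁) else 0))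
        + (∑ bb ∈ box (3 + 1) (P m), ∑' u' : Site (3 + 1), ∑' x : Site (3 + 1), ∑' z : Site (3 + 1),
          (if toSite bb κ' % ((P m : ℕ) : ℤ) = ((P m : ℕ) : ℤ) - 1 ∧ u' κ % ((P m : ℕ) : ℤ) = ((P m : ℕ) : ℤ) - 1 ∧ x κ₂ % ((P m : ℕ) : ℤ) = ((P m : ℕ) : ℤ) - 1 ∧ z κ₁ % ((P m : ℕ) : ℤ) = ((P m : ℕ) : ℤ) - 1 then
            ((fun κ u κ' u' => (cE₂ * (Lc : ℝ) ^ (2 * (3 + 1))) • mmRead Lc (K3OfK (unitK (sfStep Lc i) (smStep 3 Lc i) (GcombSh (d := 3) Lc i)) Lc (unitS (sfStep Lc i) (smStep 3 Lc i) (SpureCombOf (symTablesAn1S2 3 Lc cΛt) cE cVH cΛ i)) (unitM (sfStep Lc i) (smStep 3 Lc i) ((symTablesAn1S2 3 Lc cΛt).M i)) (W2SymOfK (unitK (sfStep Lc i) (smStep 3 Lc i) (GcombSh (d := 3) Lc i)) Lc (unitS (sfStep Lc i) (smStep 3 Lc i) (SpureCombOf (symTablesAn1S2 3 Lc cΛt)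 cE cVH cΛ i)) (unitM (sfStep Lc i) (smStep 3 Lc i) ((symTablesAn1S2 3 Lc cΛt).M i)) 0 (unitM₂ (sfStep Lc i) (smStep 3 Lc i) (M2Of 3 Lc ((symTablesAn1S2 3 Lc cΛt).mixFF) i))) κ u κ' u') + cB • (symTablesAn1S2 3 Lc cΛt).vh₂S κ u κ' u')) κ' (toSite bb) κ u' x z (Sum.inl κ₂) (Sum.inl κ₁) else 0)))
      + ((∑ bb ∈ box (3 + 1) (P m), ∑' u' : Site (3 + 1), ∑' x : Site (3 + 1), ∑' z : Site (3 + 1),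
          (if toSite bb κ' % ((P m : ℕ) : ℤ) = ((P m : ℕ) : ℤ) - 1 ∧ u' κ % ((P m : ℕ) : ℤ) = ((P m : ℕ) : ℤ) - 1 ∧ x κ₂ % ((P m : ℕ) : ℤ) = ((P m : ℕ) : ℤ) - 1 ∧ z κ₁ % ((P m : ℕ) : ℤ) = ((P m : ℕ) : ℤ) - 1 then
            ((fun κ u κ' u' => (cE₂ * (Lc : ℝ) ^ (2 * (3 + 1))) • mmRead Lc (K3OfK (unitK (sfStep Lc i) (smStep 3 Lc i) (GcombSh (d := 3) Lc i)) Lc (unitS (sfStep Lc i) (smStep 3 Lc i) (SpureCombOf (symTablesAn1S2 3 Lc cΛt) cE cVH cΛ i)) (unitM (sfStep Lc i) (smStep 3 Lc i) ((symTablesAn1S2 3 Lc cΛt).M i)) (W2SymOfK (unitK (sfStep Lc i) (smStep 3 Lc i) (GcombSh (d := 3) Lc i)) Lc (unitS (sfStep Lc i) (smStep 3 Lc i) (SpureCombOf (symTablesAn1S2 3 Lc cΛt) cE cVH cΛ i)) (unitM (sfStep Lc i) (smStep 3 Lc i) ((symTablesAn1S2 3 Lc cΛt).M i)) 0 (unitM₂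 (sfStep Lc i) (smStep 3 Lc i) (M2Of 3 Lc ((symTablesAn1S2 3 Lc cΛt).mixFF) i))) κ u κ' u') + cB • (symTablesAn1S2 3 Lc cΛt).vh₂S κ u κ' u')) κ' (toSite bb) κ u' x z (Sum.inl κ₂) (Sum.inl κ₁) else 0))
        + (∑ bb ∈ box (3 + 1) (P m), ∑' u' : Site (3 + 1), ∑' x : Site (3 + 1), ∑' z : Site (3 + 1),
          (if toSite bb κ % ((P m : ℕ) : ℤ) = ((P m : ℕ) : ℤ) - 1 ∧ u' κ' % ((P m : ℕ) : ℤ) = ((P m : ℕ) : ℤ) - 1 ∧ x κ₂ % ((P m : ℕ) : ℤ) = ((P m : ℕ) : ℤ) - 1 ∧ z κ₁ % ((P m : ℕ) : ℤ) = ((P m : ℕ) : ℤ) - 1 then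
            ((fun κ u κ' u' => (cE₂ * (Lc : ℝ) ^ (2 * (3 + 1))) • mmRead Lc (K3OfK (unitK (sfStep Lc i) (smStep 3 Lc i) (GcombSh (d := 3) Lc i)) Lc (unitS (sfStep Lc i) (smStep 3 Lc i) (SpureCombOf (symTablesAn1S2 3 Lc cΛt) cE cVH cΛ i)) (unitM (sfStep Lc i) (smStep 3 Lc i) ((symTablesAn1S2 3 Lc cΛt).M i)) (W2SymOfK (unitK (sfStep Lc i) (smStep 3 Lc i) (GcombSh (d := 3) Lc i)) Lc (unitS (sfStep Lc i) (smStep 3 Lc i) (SpureCombOf (symTablesAn1S2 3 Lc cΛt) cE cVH cΛ i)) (unitM (sfStep Lc i) (smStep 3 Lc i) ((symTablesAn1S2 3 Lc cΛt).M i)) 0 (unitM₂ (sfStep Lc i) (smStep 3 Lc i) (M2Of 3 Lc ((symTablesAn1S2 3 Lc cΛt).mixFF) i))) κ u κ' u') + cB • (symTablesAn1S2 3 Lc cΛt).vh₂S κ u κ' u')) κ (toSite bb) κ' u' x z (Sum.inl κ₂) (Sum.inl κ₁) else 0)))))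
          = T κ κ₁ κ' κ₂ + T κ' κ₁ κ κ₂ + (T κ κ₂ κ' κ₁ + T κ' κ₂ κ κ₁) :=
  forcingFacePairForms_comb_an1_of_currentSym hLc cΛt cE cVH cΛ cE₂ cB P hP0 hPs (hCS_holds cΛt cE cVH cΛ)

end Summit.QuantumFields.BalabanUV.Beta.GAN24.CurrentSymTowerComb

end
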